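import Mathlib
import Summits.Ventures.HodgeRepro.Tier4.Line1.RTFSetting
import Summits.Ventures.HodgeRepro.Tier4.Line1.KernelSupportFinite

/-!
# Tier4/Line1/L1Test — `L¹` TEST FUNCTIONS AND THE UNIFORM LATTICE COUNT: the Poincaré bound for `f₁ ⋆ f₂` with `f₁ ∈ L¹`
and `f₂` of compact support is a THEOREM (C-L1-L1RTF Part A, (0) + (1′); lead (R-9) S14756 / (R-12) S14801)

Blind re-derivation cell `pub-hodge-repro`, Tier 4 (README §9–§10), seat t4-L1-p1 (gen 3).  Target tree path
`lean/Summits/Ventures/HodgeRepro/Tier4/Line1/L1Test.lean`.  Imports `RTFSetting` and this seat's `KernelSupportFinite`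
(`finite_of_subset_compact`: a set of rational points inside a compact set is finite — `G(k)` discrete and closed).

WHAT THIS IS.  LINE L4's wall needs the RTF for an archimedean test function that is INTEGRABLE but not compactly supported
(the weight-3 discrete-series coefficient); plan-4's §15 Part A (proofs/t4-plan-4/work/v33/L1Class-STATEMENTS.lean) asks for
the class and the Poincaré bound.  Re-homed here in `Line1.RTF.Setting`:
* (0) `IsTestL1 f := Continuous f ∧ Integrable f S.μ` (plan-1 S14724; compact support NOT asked), `isTestL1_of_isTest`,
  `IsTestL1.cj` — plan-4's (0) token for token.
* THE COVER: `exists_compact_cover [LocallyCompactSpace G] : ∃ C₀, IsCompact C₀ ∧ ∀ g, ∃ γ : Gk, γ * g ∈ C₀` — `G = G(k) · C₀`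
  from `fdG.ae_covers` (a relatively compact neighbourhood of `g` has positive Haar measure, so it meets the full-measure
  set of points moved into `DG` by a rational element).
* THE UNIFORM LATTICE COUNT: `exists_bound_card_lattice (hC : IsCompact C) : ∃ N : ℕ, ∀ g : G, ∀ s : Finset Gk,
  (∀ γ ∈ s, (γ : G) ∈ g • C) → s.card ≤ N` — the number of rational points in ANY left translate `g • C` of a compact set is
  bounded by `#(G(k) ∩ C₀ · C)`: with `g = γ₀⁻¹ c` the map `γ ↦ γ₀ γ` carries `G(k) ∩ g • C` into `G(k) ∩ C₀ · C`.
* (1′) THE POINCARÉ BOUND, uniform-bound form (crit-1 S14790 / lead (R-12)): for `f₁ ∈ L¹` (`IsTestL1`) and `f₂` of compact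
  support (`IsTest`) and compacts `C₁ C₂`, there is `M` with, for every `x ∈ C₁`, `y ∈ C₂`,
  `Summable (fun γ => ‖(f₁ ⋆ f₂) (x⁻¹ γ y)‖)` and `∑' γ, ‖(f₁ ⋆ f₂) (x⁻¹ γ y)‖ ≤ M` (`poincare_uniform_of_conv`):
  `‖(f₁ ⋆ f₂)(z)‖ ≤ ∫ ‖f₁ h‖ ‖f₂ (h⁻¹ z)‖ dh`, and for every FINITE set `s` of rational points
  `∑_{γ ∈ s} ‖f₂ ((x h)⁻¹ γ y)‖ ≤ ‖f₂‖_∞ · N` because at most `N` of the `γ ∈ s` lie in the left translate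
  `(x h) • (tsupport f₂ · C₂⁻¹)` (the count is over `g := x h ∈ G`, uniform by the lemma above) — so the partial sums are
  bounded by `M := ‖f₁‖₁ · ‖f₂‖_∞ · N` and `summable_of_sum_le` / `tsum_le_of_sum_le` finish; no Tonelli.
  WHY NOT the dominating-family form of plan-4's (1) (`∃ c : Gk → ℝ, Summable c ∧ ∀ γ x y, ‖f (x⁻¹ γ y)‖ ≤ c γ` with `c`
  independent of `(x, y)`): it would need the TWO-SIDED count `#(G(k) ∩ C₁ · g · K)` uniform in `g`, which is FALSE in
  general (conjugation by `g` is not measure-bounded: for `SL₂` and a diagonal `g` the set `g⁻¹ C₁ g` stretches) — the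
  objection of crit-1 S14790 that (R-12) answered by re-typing (1) to the uniform-bound form proved here.
(2) `RtfGeometricL1` and (3) `RtfSpectralL1` are NOT in this file (the successor's, with the proof plan in HANDOFF).  0 print.
Nothing here says anything about the status of the Hodge conjecture for CM abelian varieties, which is NOT proved (HC_CM is
NOT proved by anyone in this repository).
-/

set_option autoImplicit false

noncomputable section

namespace Summit.Ventures.HodgeRepro.Tier4.Line1

open MeasureTheory Topology
open scoped Pointwise

namespace RTF

namespace Setting

variable {G : Type} [Group G] [TopologicalSpace G] [MeasurableSpace G] [hBorel : BorelSpace G]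
variable [IsTopologicalGroup G] (S : Setting G)

section Class

omit [IsTopologicalGroup G] [BorelSpace G] in
/-- **(0) an `L¹` test function**: continuous and integrable for the Haar measure of the setting (plan-1 S14724).  Compact
support is NOT asked. -/
def IsTestL1 (f : G → ℂ) : Prop := Continuous f ∧ Integrable f S.μ

omit [IsTopologicalGroup G] in
include hBorel in
/-- a test function of compact support is an `L¹` test function (Haar measures are finite on compacts). -/
theorem isTestL1_of_isTest {f : G → ℂ} (hf : IsTest f) : IsTestL1 S f := by
  haveI := S.haar
  exact ⟨hf.cont, hf.cont.integrable_of_hasCompactSupport hf.compact⟩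

omit [IsTopologicalGroup G] in
include hBorel in
/-- the conjugate of an `L¹` test function is an `L¹` test function. -/
theorem IsTestL1.cj {f : G → ℂ} (hf : IsTestL1 S f) : IsTestL1 S (RTF.cj f) := by
  refine ⟨(continuous_star : Continuous (starRingEnd ℂ)).comp hf.1, ?_⟩
  refine hf.2.norm.mono' ((continuous_star : Continuous (starRingEnd ℂ)).comp hf.1).aestronglyMeasurable ?_
  exact Filter.Eventually.of_forall fun g => by simp [RTF.cj]

end Class

section Cover

omit [BorelSpace G] in
/-- **`G = G(k) · C₀` for a compact `C₀`** (the setting's quotient is compact and `G` is locally compact): every `g` is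
moved into the compact `closure DG · U⁻¹` by a rational element, `U` a compact neighbourhood of `1` — the open set
`g • interior U` has positive Haar measure, so it meets the full-measure set of `fdG.ae_covers`. -/
theorem exists_compact_cover [LocallyCompactSpace G] :
    ∃ C₀ : Set G, IsCompact C₀ ∧ ∀ g : G, ∃ γ : S.Gk, (γ : G) * g ∈ C₀ := by
  haveI := S.haar
  obtain ⟨U, hU, hU1⟩ := exists_compact_mem_nhds (1 : G)
  refine ⟨(fun p : G × G => p.1 * p.2⁻¹) '' (closure S.DG ×ˢ U), ?_, fun g => ?_⟩
  · exact (S.compG.prod hU).image (continuous_fst.mul continuous_snd.inv)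
  · have hopen : IsOpen (g • interior U) := isOpen_interior.leftCoset g
    have hne : (g • interior U).Nonempty := ⟨g, 1, mem_interior_iff_mem_nhds.mpr hU1, by simp⟩
    have hpos : 0 < S.μ (g • interior U) := hopen.measure_pos S.μ hne
    have hae : ∀ᵐ y ∂S.μ, ∃ γ : S.Gk, γ • y ∈ S.DG := S.fdG.ae_covers
    have hmeet : ∃ y ∈ g • interior U, ∃ γ : S.Gk, γ • y ∈ S.DG := by
      by_contra hcon
      push Not at hcon
      have hsub : g • interior U ⊆ {y | ¬ ∃ γ : S.Gk, γ • y ∈ S.DG} := by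
        intro y hy
        simp only [Set.mem_setOf_eq, not_exists]
        exact hcon y hy
      have h0 : S.μ {y | ¬ ∃ γ : S.Gk, γ • y ∈ S.DG} = 0 := ae_iff.mp hae
      exact absurd (measure_mono_null hsub h0) hpos.ne'
    obtain ⟨y, hy, γ, hγ⟩ := hmeet
    obtain ⟨u, hu, rfl⟩ := hy
    refine ⟨γ, ⟨((γ : G) * (g • u), u), ⟨subset_closure hγ, interior_subset hu⟩, ?_⟩⟩
    simp only [smul_eq_mul]
    group

omit [BorelSpace G] in
/-- **THE UNIFORM LATTICE COUNT**: the number of rational points in any left translate `g • C` of a compact `C` is bounded,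
uniformly in `g ∈ G`, by `#(G(k) ∩ C₀ · C)`. -/
theorem exists_bound_card_lattice [LocallyCompactSpace G] {C : Set G} (hC : IsCompact C) :
    ∃ N : ℕ, ∀ g : G, ∀ s : Finset S.Gk, (∀ γ ∈ s, (γ : G) ∈ g • C) → s.card ≤ N := by
  classical
  obtain ⟨C₀, hC₀, hcov⟩ := S.exists_compact_cover
  have hK : IsCompact ((fun p : G × G => p.1 * p.2) '' (C₀ ×ˢ C)) :=
    (hC₀.prod hC).image (continuous_fst.mul continuous_snd)
  have hfin : {γ : S.Gk | (γ : G) ∈ (fun p : G × G => p.1 * p.2) '' (C₀ ×ˢ C)}.Finite :=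
    S.finite_of_subset_compact hK fun γ hγ => hγ
  refine ⟨hfin.toFinset.card, fun g s hs => ?_⟩
  obtain ⟨γ₀, hγ₀⟩ := hcov g
  -- `γ ↦ γ₀ γ` is an injection of `s` into the finite set
  have hmaps : ∀ γ ∈ s, γ₀ * γ ∈ hfin.toFinset := by
    intro γ hγ
    rw [Set.Finite.mem_toFinset]
    obtain ⟨c, hc, hgc⟩ := hs γ hγ
    refine ⟨((γ₀ : G) * g, c), ⟨hγ₀, hc⟩, ?_⟩
    simp only [Subgroup.coe_mul]
    rw [← hgc]
    simp only [smul_eq_mul]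
    group
  calc s.card = (s.image fun γ => γ₀ * γ).card := by
        rw [Finset.card_image_of_injective _ (mul_right_injective γ₀)]
    _ ≤ hfin.toFinset.card := by
        apply Finset.card_le_card
        intro γ' hγ'
        obtain ⟨γ, hγ, rfl⟩ := Finset.mem_image.mp hγ'
        exact hmaps γ hγ

end Cover

section Poincare

variable [LocallyCompactSpace G]

omit [Group G] [MeasurableSpace G] hBorel [IsTopologicalGroup G] [LocallyCompactSpace G] in
/-- a continuous function of compact support is bounded. -/
theorem exists_bound_of_isTest {f : G → ℂ} (hf : IsTest f) : ∃ B : ℝ, 0 ≤ B ∧ ∀ x, ‖f x‖ ≤ B := by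
  obtain ⟨C, hC⟩ := hf.compact.isCompact.exists_bound_of_continuousOn hf.cont.continuousOn
  refine ⟨max C 0, le_max_right _ _, fun x => ?_⟩
  by_cases hx : x ∈ tsupport f
  · exact (hC x hx).trans (le_max_left _ _)
  · rw [image_eq_zero_of_notMem_tsupport hx, norm_zero]
    exact le_max_right _ _

omit [LocallyCompactSpace G] in
include hBorel in
/-- the integrand of the convolution is integrable: `‖f₁‖ ∈ L¹` times the bounded `‖f₂ (·⁻¹ z)‖`. -/
theorem integrable_norm_mul_norm {f₁ f₂ : G → ℂ} (hf₁ : IsTestL1 S f₁) (hf₂ : IsTest f₂) (z : G) :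
    Integrable (fun h => ‖f₁ h‖ * ‖f₂ (h⁻¹ * z)‖) S.μ := by
  obtain ⟨B, -, hB⟩ := exists_bound_of_isTest hf₂
  have hcont : Continuous fun h : G => ‖f₂ (h⁻¹ * z)‖ :=
    (hf₂.cont.comp (continuous_inv.mul continuous_const)).norm
  have h := hf₁.2.norm.bdd_mul (c := B) hcont.aestronglyMeasurable
    (Filter.Eventually.of_forall fun h => by rw [norm_norm]; exact hB _)
  refine h.congr (Filter.Eventually.of_forall fun h => ?_)
  simp only
  ring

omit hBorel [IsTopologicalGroup G] [LocallyCompactSpace G] in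
/-- the pointwise bound `‖(f₁ ⋆ f₂) z‖ ≤ ∫ ‖f₁ h‖ ‖f₂ (h⁻¹ z)‖`. -/
theorem norm_conv_le_integral_norm_mul (f₁ f₂ : G → ℂ) (z : G) :
    ‖S.conv f₁ f₂ z‖ ≤ ∫ h, ‖f₁ h‖ * ‖f₂ (h⁻¹ * z)‖ ∂S.μ := by
  unfold conv
  refine (norm_integral_le_integral_norm _).trans (le_of_eq ?_)
  refine integral_congr_ae (Filter.Eventually.of_forall fun h => ?_)
  simp

include hBorel in
/-- **(1′) THE POINCARÉ BOUND, uniform-bound form** (crit-1 S14790 / lead (R-12)): for `f₁ ∈ L¹` and `f₂` of compact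
support, on every pair of compacts `C₁ C₂` the kernel series `∑_γ ‖(f₁ ⋆ f₂)(x⁻¹ γ y)‖` is summable and bounded by
`M := ‖f₁‖₁ · ‖f₂‖_∞ · N`, uniformly in `x ∈ C₁`, `y ∈ C₂` — `N` the uniform lattice count of the compact
`tsupport f₂ · C₂⁻¹`: for a finite set `s` of rational points at most `N` of the `γ ∈ s` have
`(x h)⁻¹ γ y ∈ tsupport f₂`, so `∑_{γ ∈ s} ‖f₂ ((x h)⁻¹ γ y)‖ ≤ ‖f₂‖_∞ N` for every `h`, and the partial sums of the
kernel series are bounded by `M`; no Tonelli, no finite support of `f₁`. -/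
theorem poincare_uniform_of_conv {f₁ f₂ : G → ℂ} (hf₁ : IsTestL1 S f₁) (hf₂ : IsTest f₂) {C₁ C₂ : Set G}
    (_h₁ : IsCompact C₁) (h₂ : IsCompact C₂) :
    ∃ M : ℝ, ∀ x ∈ C₁, ∀ y ∈ C₂, Summable (fun γ : S.Gk => ‖S.conv f₁ f₂ (x⁻¹ * γ * y)‖) ∧
      ∑' γ : S.Gk, ‖S.conv f₁ f₂ (x⁻¹ * γ * y)‖ ≤ M := by
  classical
  haveI := S.haar
  obtain ⟨B, hB0, hB⟩ := exists_bound_of_isTest hf₂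
  have hK' : IsCompact ((fun p : G × G => p.1 * p.2⁻¹) '' (tsupport f₂ ×ˢ C₂)) :=
    (hf₂.compact.isCompact.prod h₂).image (continuous_fst.mul continuous_snd.inv)
  obtain ⟨N, hN⟩ := S.exists_bound_card_lattice hK'
  refine ⟨(∫ h, ‖f₁ h‖ ∂S.μ) * (B * N), fun x _ y hy => ?_⟩
  -- the pointwise count: for every `h` and finite `s`, `∑_{γ ∈ s} ‖f₂ (h⁻¹ (x⁻¹ γ y))‖ ≤ B N`
  have hpt : ∀ (h : G) (s : Finset S.Gk), ∑ γ ∈ s, ‖f₂ (h⁻¹ * (x⁻¹ * γ * y))‖ ≤ B * N := by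
    intro h s
    set t := s.filter fun γ : S.Gk => f₂ (h⁻¹ * (x⁻¹ * γ * y)) ≠ 0 with ht
    have hsum : ∑ γ ∈ s, ‖f₂ (h⁻¹ * (x⁻¹ * γ * y))‖ = ∑ γ ∈ t, ‖f₂ (h⁻¹ * (x⁻¹ * γ * y))‖ := by
      rw [ht, Finset.sum_filter]
      refine Finset.sum_congr rfl fun γ _ => ?_
      by_cases hγ : f₂ (h⁻¹ * (x⁻¹ * γ * y)) ≠ 0
      · rw [if_pos hγ]
      · rw [if_neg hγ]
        push Not at hγ
        rw [hγ, norm_zero]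
    have hcard : t.card ≤ N := by
      refine hN (x * h) t fun γ hγ => ?_
      rw [ht, Finset.mem_filter] at hγ
      have hmem : h⁻¹ * (x⁻¹ * γ * y) ∈ tsupport f₂ := subset_tsupport f₂ hγ.2
      refine ⟨(h⁻¹ * (x⁻¹ * γ * y)) * y⁻¹, ⟨(h⁻¹ * (x⁻¹ * γ * y), y), ⟨hmem, hy⟩, rfl⟩, ?_⟩
      simp only [smul_eq_mul]
      group
    calc ∑ γ ∈ s, ‖f₂ (h⁻¹ * (x⁻¹ * γ * y))‖ = ∑ γ ∈ t, ‖f₂ (h⁻¹ * (x⁻¹ * γ * y))‖ := hsum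
      _ ≤ ∑ _γ ∈ t, B := Finset.sum_le_sum fun γ _ => hB _
      _ = t.card * B := by rw [Finset.sum_const, nsmul_eq_mul]
      _ ≤ N * B := by
          have : (t.card : ℝ) ≤ N := by exact_mod_cast hcard
          exact mul_le_mul_of_nonneg_right this hB0
      _ = B * N := mul_comm _ _
  -- the partial sums of the kernel series are bounded by `M`
  have key : ∀ s : Finset S.Gk, ∑ γ ∈ s, ‖S.conv f₁ f₂ (x⁻¹ * γ * y)‖ ≤ (∫ h, ‖f₁ h‖ ∂S.μ) * (B * N) := by
    intro s
    calc ∑ γ ∈ s, ‖S.conv f₁ f₂ (x⁻¹ * γ * y)‖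
        ≤ ∑ γ ∈ s, ∫ h, ‖f₁ h‖ * ‖f₂ (h⁻¹ * (x⁻¹ * γ * y))‖ ∂S.μ :=
          Finset.sum_le_sum fun γ _ => S.norm_conv_le_integral_norm_mul f₁ f₂ _
      _ = ∫ h, ∑ γ ∈ s, ‖f₁ h‖ * ‖f₂ (h⁻¹ * (x⁻¹ * γ * y))‖ ∂S.μ :=
          (integral_finsetSum s fun γ _ => S.integrable_norm_mul_norm hf₁ hf₂ _).symm
      _ ≤ ∫ h, ‖f₁ h‖ * (B * N) ∂S.μ := by
          refine integral_mono (integrable_finsetSum s fun γ _ => S.integrable_norm_mul_norm hf₁ hf₂ _)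
            (hf₁.2.norm.mul_const _) fun h => ?_
          simp only
          rw [← Finset.mul_sum]
          exact mul_le_mul_of_nonneg_left (hpt h s) (norm_nonneg _)
      _ = (∫ h, ‖f₁ h‖ ∂S.μ) * (B * N) := integral_mul_const _ _
  have hsumm : Summable (fun γ : S.Gk => ‖S.conv f₁ f₂ (x⁻¹ * γ * y)‖) :=
    summable_of_sum_le (fun γ => norm_nonneg _) key
  exact ⟨hsumm, Real.tsum_le_of_sum_le (fun γ => norm_nonneg _) key⟩

end Poincare

end Setting

end RTF

end Summit.Ventures.HodgeRepro.Tier4.Line1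

end
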